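import Summits.BirchSwinnertonDyer.BirchSwinnertonDyer.Theorems.AlignedTransportAtTwoMainConjectureOfRankZeroBSDAtTwoTwinValue
import Summits.BirchSwinnertonDyer.BirchSwinnertonDyer.Theorems.LambdaTransportDoorAtTwoValueAtMinusTwo
import HarnessLib

/-!
# Route `AlignedTransportAtTwo`, crux C2 `MainConjectureOfRankZeroBSDAtTwo` (stmt-BirchSwinnertonDyer-22298):
# THE TWIN VALUE IS MC-NECESSARY AND EXPLICIT — under Mazur's `2`-adic main conjecture the displayed input of the twin-value door
# is `ord₂ f_X(−2) = v₂(ϖ·S₈(f))`, `S₈(f) = ∑_{a mod 8} χ₈(a)[a/8]⁺_f` (four modular symbols); and UNCONDITIONALLY the twin value is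
# never `1` below a curve of Euler weight `≥ 2` (the two values of an `ι`-stable series are both `≤ 1` and equal, or both `≥ 2`)

HONEST FRAMING (cell `bsd-f1-sign2`, WIDTH-5 attached prover seat `bsd-line-att-p5` gen 49 on line `birth` of the lead
`bsd-line-att-p2`; `--supports` stmt-BirchSwinnertonDyer-22298, closes nothing; BSD is NOT proved by any of this; the crux
C2, its verdict «blocked-on `Rank1Residual.GreenbergMuConjectureIrreducible`» and every registered stub are untouched).
THEOREMS ONLY — no `def`, no instance, no named fact, no `sorry`. Sequel of `…TwinValue` (att-p5 g49); the analytic input is the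
bsd-rank2 cell's tree theorem `LambdaTransportDoorAtTwoValueAtMinusTwo.coe_unitRoot_pow_mul_evalAt_negTwo`
(Mazur–Tate–Teitelbaum interpolation at `χ₈`, VALUE form: `α³·g(−2) = c·S₈(f)` for every integral model `g` of `c·L₂(E,T)`).

* §1 (algebra) `two_le_min_of_two_le_max`: for an `ι`-stable `F ≠ 0` with `F(0)F(−2) ≠ 0`, **`2 ≤ max(a,b) ⟹ 2 ≤ min(a,b)`**
  (`a = ord₂ F(0)`, `b = ord₂ F(−2)`; the dichotomy of `…TwinValueDichotomy`): the pair `(a,b)` is `(0,0)`, `(1,1)` or `≥ (2,2)`.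
  Datum: `two_le_twinValue_of_two_le_weight` — **Euler weight `e(W) ≥ 2 ⟹ ord₂ f_X(−2) ≥ 2`** for every generator with `f_X(−2) ≠ 0`
  (PRINT `h114`): the twin value is NEVER `1` on the C2 cell — a falsifiable prediction (`v₂(S₈(f)) ≥ 2` under MC; census: 242/242).
* §2 (NECESSITY) ★★ `twinValue_of_mazurMainConjecture`: `MazurMainConjecture W 2`, good ordinary at `2`, newform `f` at the conductor level,
  `ϖ·Ω(W) = Ω⁺_f` ⟹ at every normalised datum there is a generator `g` of `char_Λ X` with **`α³·g(−2) = ϖ·S₈(f)` in `ℚ₂`**, hence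
  `‖g(−2)‖₂ = ‖ϖ·S₈(f)‖₂` (`norm_evalAt_charGen_eq_of_mazurMainConjecture`): the door's displayed hypothesis is a CONSEQUENCE of what it
  proves (no junk/vacuity), and it is decided by four modular symbols — `ord₂ f_X(−2) = v₂(S₈(f))` on the cell, where `ϖ` is a `2`-adic
  unit (Abbes–Ullmo, `hper`).

References: B. Mazur, J. Tate, J. Teitelbaum, Invent. Math. 84 (1986) §I.14, Ch. I §17 [MazurTateTeitelbaum1986Invent]; R. Greenberg, LNM
1716 (1999) Thm. 1.14, Thm. 4.1 [GreenbergLNM1716]; A. Abbes, E. Ullmo, Compositio 103 (1996) Thm. A [AbbesUllmo1996].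
-/

set_option linter.dupNamespace false
set_option autoImplicit false

noncomputable section

open scoped Classical MatrixGroups ModularForm

namespace Summit.BirchSwinnertonDyer.BirchSwinnertonDyer.Theorems.AlignedTransportAtTwoTwinValueNecessity

open PowerSeries CongruenceSubgroup WeierstrassCurve Literature.NumberTheory.EllipticCurves
  Literature.NumberTheory.EllipticCurves.IwasawaAlgebra
  Literature.NumberTheory.EllipticCurves.ModularForms
  Literature.NumberTheory.EllipticCurves.Greenberg1999
  Summit.BirchSwinnertonDyer.Rank1Residual.X1.MuLambda
  Summit.BirchSwinnertonDyer.Rank1Residual.Supersingular Summit.BirchSwinnertonDyer.Rank1Residual.Supersingular.BlindLever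
  Summit.BirchSwinnertonDyer.BirchSwinnertonDyer.Theorems.Rank1ResidualX1Defs
  Summit.BirchSwinnertonDyer.BirchSwinnertonDyer.Theorems
  Summit.BirchSwinnertonDyer.BirchSwinnertonDyer.Theorems.AlignedTransportAtTwoTwinValueAlgebra
  Summit.BirchSwinnertonDyer.BirchSwinnertonDyer.Theorems.AlignedTransportAtTwoTwinValue
  Summit.BirchSwinnertonDyer.BirchSwinnertonDyer.Theorems.AlignedTransportAtTwoTwistSaturation
  Summit.BirchSwinnertonDyer.BirchSwinnertonDyer.Theorems.AlignedTransportAtTwoCyclotomicLayerWeightEuler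
  Summit.BirchSwinnertonDyer.BirchSwinnertonDyer.Theorems.TwoAdicEulerCharKernel
  Summit.BirchSwinnertonDyer.BirchSwinnertonDyer.Theorems.LambdaTransportDoorAtTwoValueAtMinusTwo

/-! ## §1 The twin value is never `1` under a weight `≥ 2` -/

section NeverOne

/-- **`2 ≤ max(a, b) ⟹ 2 ≤ min(a, b)`** for an `ι`-stable `F ≠ 0` in `ℤ₂⟦T⟧` with `F(0) ≠ 0`, `F(−2) ≠ 0` (`a = ord₂ F(0)`, `b = ord₂ F(−2)`):
the dichotomy `a = b ∨ (μ+2 ≤ a ∧ μ+2 ≤ b)`. [cite: GreenbergLNM1716, Thm. 1.14 and §4 p. 107] [cite: MazurTateTeitelbaum1986Invent, Ch. I §17] -/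
theorem two_le_min_of_two_le_max {F : IwasawaAlgebra 2} (hF0 : F ≠ 0) (hι : ∃ u : (IwasawaAlgebra 2)ˣ, invol 2 F = u * F)
    (h0 : constantCoeff F ≠ 0) (h2 : evalAt (-2 : ℤ_[2]) F ≠ 0)
    (hmax : 2 ≤ (constantCoeff F).valuation ∨ 2 ≤ (evalAt (-2 : ℤ_[2]) F).valuation) :
    2 ≤ (constantCoeff F).valuation ∧ 2 ≤ (evalAt (-2 : ℤ_[2]) F).valuation := by
  rcases twinValue_dichotomy _ F hF0 le_rfl hι h0 h2 with h | ⟨ha, hb⟩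
  · rcases hmax with hm | hm <;> constructor <;> omega
  · constructor <;> omega

variable (κ : ZpExtension ℚ 2) (hκ : κ.IsCyclotomic) {γ : Field.absoluteGaloisGroup ℚ} (hγ : κ.IsTopGenerator γ)
  (hγ' : IsCyclotomicVariable 2 γ) (W : WeierstrassCurve ℚ) [W.IsElliptic] [W.IsGloballyMinimal]

include hκ hγ hγ' in
/-- ★ **THE TWIN VALUE IS NEVER `1` ON THE CELL.** `W/ℚ` globally minimal, good ordinary at `2`, `Sel_{2^∞}(W/ℚ)` finite, `(κ, γ)` the
normalised cyclotomic datum, `D` any dual datum, `f_X` a generator of `char_Λ X` with `f_X(−2) ≠ 0`; data `t, e, s` with Euler weight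
`w = ord₂ ∏c_ℓ + 2e + s − 2t ≥ 2` (e.g. every curve with `E(ℚ)[2] = 0`: `#Ẽ(𝔽₂) ∈ {2, 4}`); PRINT `h114`. Then **`2 ≤ ord₂ f_X(−2)`**.
Reading: on the clean cell `ord₂ #Ш(W/ℚ(√2))[2^∞] ≥ 2` and, under MC, `v₂(S₈(f)) ≥ 2` — a falsifiable prediction of the `ι`-symmetry alone.
[cite: GreenbergLNM1716, Thm. 1.14 (p. 68), Thm. 4.1 (p. 102)] [cite: MazurTateTeitelbaum1986Invent, Ch. I §17] -/
theorem two_le_twinValue_of_two_le_weight (h114 : Greenberg1999_thm114_charIdeal_iota_invariant) (hord : IsOrdinaryAt W 2)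
    (D : W.SelmerDualData κ γ) (hfin : Finite (W.selmerGroupPInfty 2)) {t e s : ℕ}
    (ht : Nat.card (AddCommGroup.primaryComponent W.toAffine.Point 2) = 2 ^ t)
    (he : Nat.card (AddCommGroup.primaryComponent ((integralModelInt W).map (Int.castRingHom (ZMod 2))).toAffine.Point 2) = 2 ^ e)
    (hs : Nat.card (W.selmerGroupPInfty 2) = 2 ^ s) {fX : IwasawaAlgebra 2} (hchar : D.charIdeal = Ideal.span {fX})
    (h2 : evalAt (-2 : ℤ_[2]) fX ≠ 0) (hw : 2 ≤ padicValNat 2 W.tamagawaProduct + 2 * e + s - 2 * t) :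
    2 ≤ (evalAt (-2 : ℤ_[2]) fX).valuation := by
  haveI : Module.Finite (IwasawaAlgebra 2) D.X := D.module_finite_holds hγ
  have hD : D.IsTorsion := isTorsion_of_finite κ hκ hγ W hord D hfin
  obtain ⟨-, hnorm⟩ := norm_constantCoeff_charGen_eq_of_thm41 W thm41_charValue_rankZero_anyPrime_holds
    ((isOrdinaryAt_iff W 2).mp hord).1 ((isOrdinaryAt_iff W 2).mp hord).2 hκ hγ hγ' D hD hchar hfin ht he hs
  obtain ⟨hc0, hval⟩ := valuation_eq_of_norm_eq_two_inv_pow hnorm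
  have hfXne : fX ≠ 0 := fun h0 ↦ hc0 (by rw [h0, map_zero])
  have hι := iotaStable_charGen_of_thm114 h114 W hord hκ hγ D hD hchar
  exact (two_le_min_of_two_le_max hfXne hι hc0 h2 (Or.inl (by rw [hval]; exact hw))).2

end NeverOne

/-! ## §2 NECESSITY: under Mazur's main conjecture the twin value is `v₂(ϖ·S₈(f))` -/

section Necessity

variable (W : WeierstrassCurve ℚ) [W.IsElliptic] [W.IsGloballyMinimal]

/-- ★★ **THE TWIN VALUE UNDER THE MAIN CONJECTURE.** `W/ℚ` globally minimal, good ordinary at `2`, `f` its newform at the conductor level,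
`ϖ ∈ ℚ` with `ϖ·Ω(W) = Ω⁺_f`, `α` the unit root. If `MazurMainConjecture W 2` holds then at every normalised cyclotomic datum `(κ, γ)` and every
dual datum `D` there is a generator `g` of `char_Λ D.X` with **`α³ · g(−2) = ϖ · S₈(f)` in `ℚ₂`**, `S₈(f) = ∑_{a mod 8} χ₈(a)[a/8]⁺_f`
(MC gives `ι g = ϖ·L₂(f, α)`; MTT at `χ₈` in value form, tree `coe_unitRoot_pow_mul_evalAt_negTwo`). So the twin value of the door is
MC-NECESSARY and explicit: `ord₂ f_X(−2) = v₂(ϖ) + v₂(S₈(f))`. [cite: MazurTateTeitelbaum1986Invent, §I.14 Proposition (p. 20)]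
[cite: GreenbergLNM1716, Thm. 4.1 (p. 102)] -/
theorem twinValue_of_mazurMainConjecture (hMC : MazurMainConjecture W 2) (hord : IsOrdinaryAt W 2) [NeZero (W.conductorNorm ℤ)]
    (f : CuspForm (Gamma0 (W.conductorNorm ℤ)) 2) (hf : IsNewformOf W f) (ϖ : ℚ) (hϖ : (ϖ : ℝ) * W.realPeriodRat = plusPeriod f)
    {κ : ZpExtension ℚ 2} {γ : Field.absoluteGaloisGroup ℚ} (hκ : κ.IsCyclotomic) (hγ : κ.IsTopGenerator γ)
    (hγ' : IsCyclotomicVariable 2 γ) (D : W.SelmerDualData κ γ) :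
    ∃ g : IwasawaAlgebra 2, D.charIdeal = Ideal.span {g} ∧
      ((unitRoot W 2 ^ 3 * evalAt (-2 : ℤ_[2]) g : ℤ_[2]) : ℚ_[2]) =
        (ϖ : ℚ_[2]) * ((ratTwistedSymbolSum f (ZMod.χ₈.ringHomComp (Int.castRingHom ℚ)) : ℚ) : ℚ_[2]) := by
  obtain ⟨-, g, hchar, hg⟩ := hMC κ γ hκ hγ hγ' f hf ϖ hϖ D
  exact ⟨g, hchar, coe_unitRoot_pow_mul_evalAt_negTwo hord hf hg⟩

/-- ★★ **Norm form**: under `MazurMainConjecture W 2`, at every normalised datum some generator `g` of `char_Λ X` has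
**`‖g(−2)‖₂ = ‖ϖ · S₈(f)‖₂`** (`α` is a `2`-adic unit). With `hper` (Abbes–Ullmo: `ϖ` a `2`-adic unit on the cell) this reads
`ord₂ f_X(−2) = v₂(S₈(f))`; in particular `f_X(−2) ≠ 0 ⟺ S₈(f) ≠ 0 ⟺ L(W⁽²⁾,1) ≠ 0` (Birch). [cite: MazurTateTeitelbaum1986Invent, §I.14 Proposition (p. 20)] -/
theorem norm_evalAt_charGen_eq_of_mazurMainConjecture (hMC : MazurMainConjecture W 2) (hord : IsOrdinaryAt W 2)
    [NeZero (W.conductorNorm ℤ)] (f : CuspForm (Gamma0 (W.conductorNorm ℤ)) 2) (hf : IsNewformOf W f) (ϖ : ℚ)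
    (hϖ : (ϖ : ℝ) * W.realPeriodRat = plusPeriod f) {κ : ZpExtension ℚ 2} {γ : Field.absoluteGaloisGroup ℚ} (hκ : κ.IsCyclotomic)
    (hγ : κ.IsTopGenerator γ) (hγ' : IsCyclotomicVariable 2 γ) (D : W.SelmerDualData κ γ) :
    ∃ g : IwasawaAlgebra 2, D.charIdeal = Ideal.span {g} ∧
      ‖((evalAt (-2 : ℤ_[2]) g : ℤ_[2]) : ℚ_[2])‖ =
        ‖(ϖ : ℚ_[2]) * ((ratTwistedSymbolSum f (ZMod.χ₈.ringHomComp (Int.castRingHom ℚ)) : ℚ) : ℚ_[2])‖ := by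
  obtain ⟨g, hchar, hg⟩ := twinValue_of_mazurMainConjecture W hMC hord f hf ϖ hϖ hκ hγ hγ' D
  refine ⟨g, hchar, ?_⟩
  have hα : IsUnit (unitRoot W 2) := ((unitRoot_spec_holds W 2) hord).2
  have hαn : ‖((unitRoot W 2 : ℤ_[2]) : ℚ_[2])‖ = 1 := by
    rw [← PadicInt.norm_def]; exact PadicInt.isUnit_iff.mp hα
  rw [← hg]
  push_cast
  rw [norm_mul, norm_pow, hαn, one_pow, one_mul]

end Necessity

end Summit.BirchSwinnertonDyer.BirchSwinnertonDyer.Theorems.AlignedTransportAtTwoTwinValueNecessity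

end
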